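/-
Copyright (c) 2026 the pub-hodgecm-mathlib formalisation cell (harness21).  Prover seat hodgecm-mathlib-K2Liu-p06 (g2): Track B «K2-LIT»,
#184♮ = hLiu418 = stmt-HodgeConjecture-24832; organ O33.2 for socket #33s `sig_K2LiuZetaSNonvanishingData` of the tier-1 socket module
`Cruxes/HLiu418/Lines/K2_Liu_CurveThetaSigs_U5d_ZetaS.lean` (ED. 2, sha16 658c80e5f6458509, :420; LEAD F0P6-plan (g10) RE-DEAL 2026-09-04T02:26:33Z); 2026-09-04.
-/
import Literature.NumberTheory.K2Lit.LocalDoublingZeta                          -- ★ `zetaS`, `placesEmbed`, `quotMatrixCoeff`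
import Literature.NumberTheory.Automorphic.AutomorphicSpectrumProofs            -- ★ `isStronglyContinuous_rightRegular_holds`
import Literature.NumberTheory.Automorphic.DiscreteSummandProjection            -- ★ `rightRegular_apply_coeFn_of_ae_eq`
import Literature.NumberTheory.Automorphic.UnitaryGroupArchTopology             -- ★ instance: `G_∞` second countable
import Literature.NumberTheory.Automorphic.UnitaryGroupPureTensorEulerProduct   -- ★ `secondCountableTopology_localPi`
import Summits.HodgeConjecture.HodgeConjecture.Theorems.K2LiuCyclicSpanNonvanishing   -- ★ organ O33.1
import Summits.HodgeConjecture.HodgeConjecture.Theorems.K2LiuQuotMatrixCoeffContinuous -- ★ `exists_norm_le_of_continuous`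
import Mathlib.MeasureTheory.Function.L2Space
import HarnessLib

/-!
# Crux `HLiu418`, Track B road `K2_Liu`, unit U5d «`Z_S`», socket #33s — organ O33.2:
# the doubling value `Z_S(φ, φ₁, φ₁(g₀ • ·))` is the inner product `⟪R(g₀⁻¹)[φ₁], T_{f_φ}[φ₁]⟫` in `L²([G])`

Cell `hodgecm-mathlib`, crux item hLiu418 = `stmt-HodgeConjecture-24832`, route of record `HCCMUnconditional`; squad K2 ∕ K2Liu,
LEAD F0P6-plan (g10), planner K2Liu-plan (g2), prover K2Liu-p06 (g2).  THEOREMS ONLY (no `def`, no instance, no notation, no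
named-fact hypothesis, no `sorry`, default heartbeats); lane `--supports stmt-HodgeConjecture-24832` (count-neutral helper).

WHAT IS PROVED.  Part A (any `𝒢 : AdelicGroupData K`, `μ` a `G(𝔸)`-invariant measure on `[G] = G(K) A_G \ G(𝔸)`, `R = rightRegular μ`
the ★ regular representation on `L²([G], μ)`, `[φ] := MemLp.toLp φ` the class of an `L²` function):
* `memLp_two_of_continuous` — a continuous function on a compact quotient of finite volume is `L²`;
* `memLp_comp_smul`, `toLp_comp_smul_eq_rightRegular_inv` — `[φ(g₀ • ·)] = R(g₀⁻¹)[φ]`;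
* `quotMatrixCoeff_eq_inner` — the ★ matrix coefficient `⟨π(g)φ₁, φ₂⟩ = ∫ φ₁(g⁻¹•x) conj(φ₂ x) dμ` IS `⟪[φ₂], R(g)[φ₁]⟫_{L²}` (Mathlib's inner
  product is conjugate-linear in the first slot); `quotMatrixCoeff_translate_eq_inner` — `⟨π(g)φ₁, φ₁(g₀•·)⟩ = ⟪R(g₀⁻¹)[φ₁], R(g)[φ₁]⟫`;
* `integrable_smul_rightRegular` — for an `L¹` weight `f` on a second-countable Borel space `X` and a continuous `p : X → G(𝔸)`, the vector
  integrand `x ↦ f(x) • R(p x) F` is Bochner integrable (strong continuity ★ `isStronglyContinuous_rightRegular_holds`, `‖R(g)F‖ = ‖F‖`);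
* `integral_mul_quotMatrixCoeff_translate_eq_inner` — `∫ f(x) ⟨π(p x)φ₁, φ₁(g₀•·)⟩ dν = ⟪R(g₀⁻¹)[φ₁], ∫ f(x) • R(p x)[φ₁] dν⟫` (Mathlib
  `integral_inner`).
Part B (the frame of socket #33s: `G = U(H)` over the CM field `L`, `X = G_∞ × G_S`, `p = placesEmbed S`, weight
`f_φ(x) = φ(ι(ιA(p x), 1))` read from a section `φ` on the doubled group):
* `integrable_section_smul_rightRegular` — `f_φ ∈ L¹(G_∞ × G_S) ⇒ x ↦ f_φ(x) • R(p x) F` integrable;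
* `zetaS_translate_eq_inner` — **`Z_S(φ, φ₁, φ₁(g₀•·)) = ⟪R(g₀⁻¹)[φ₁], T_{f_φ}[φ₁]⟫`**, `T_{f_φ}[φ₁] := ∫ f_φ(x) • R(p x)[φ₁] d(ν_∞ ⊗ ⊗_{v∈S} ν_v)`;
* `exists_zetaS_translate_ne_zero` ∕ `exists_zetaS_translate_ne_zero_of_continuous` — **if the smear `T_{f_φ}[φ₁]` is non-zero, then
  `Z_S(φ, φ₁, φ₁(g₀•·)) ≠ 0` for some `g₀ ∈ G(𝔸)`** (by ★ organ O33.1 `exists_inner_integral_smul_translate_ne_zero`: the smear lies in the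
  cyclic closed span of `[φ₁]`).
This is step §1 (O33.2) of the #33s reduction (memo `K2/K2Liu-p06/g2/REPORT-FIRST-33s-ZetaSNonvanishingData.K2Liup06g2.md`): the socket's
`∃ g₀, zetaS … φ φ₁ (φ₁(g₀ • ·)) ≠ 0` is reduced to the non-vanishing of ONE vector `T_{f_φ}[φ₁] ∈ L²([G])`.

HONEST LABEL.  Count-neutral scaffold file of the K2_Liu road; it pays nothing by itself: `HC_CM` is proved only modulo the 7 printed citations
(2 remaining named inputs: hLiu418 = `stmt-HodgeConjecture-24832`, h413 = `stmt-HodgeConjecture-24833`) until rung 0 closes.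

## References
* [BorelJacquet1979] A. Borel, H. Jacquet, Automorphic forms and automorphic representations, PSPM 33.1 (1979): §4.6 (`(R(g)φ)(y) = φ(yg)` on `L²`).
* [Liu2011] Y. Liu, Algebra Number Theory 5 (2011): §2B Prop. 2.3 p. 862 (the doubling integral `Z_S` and its non-vanishing for a good second vector).
* [Folland1995] G. B. Folland, *A Course in Abstract Harmonic Analysis* (1995): §3.1–3.2 (integrated unitary representations).
-/

set_option autoImplicit false
set_option linter.dupNamespace false

noncomputable section

open scoped InnerProductSpace ENNReal RestrictedProduct
open MeasureTheory Filter Topology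

namespace Summit.HodgeConjecture.HodgeConjecture.Cruxes.HLiu418.K2LiuZetaSInnerProduct

open Literature.NumberTheory.Automorphic Literature.NumberTheory.GaloisRepresentations
open Literature.NumberTheory.GelbartRogawski1991 Literature.NumberTheory.GelbartRogawski1991.GRConstruction
open Literature.NumberTheory.K2Lit.PlaceSplitting Literature.NumberTheory.K2Lit.SiegelDoubled
open Summit.HodgeConjecture.HodgeConjecture.Cruxes.HLiu418.K2LiuCyclicSpanNonvanishing
open Summit.HodgeConjecture.HodgeConjecture.Cruxes.HLiu418.K2LiuQuotMatrixCoeffContinuous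

/-! ### Part A — matrix coefficients of `L²` functions as inner products of the regular representation -/

section General

variable {K : Type} [Field K] [NumberField K] (𝒢 : AdelicGroupData.{0} K) (μ : Measure 𝒢.automorphicQuotient)

/-- A continuous function on a compact automorphic quotient of finite volume is square integrable. [cite: BorelJacquet1979, §4.6] -/
theorem memLp_two_of_continuous [IsFiniteMeasure μ] [CompactSpace 𝒢.automorphicQuotient]
    {φ : 𝒢.automorphicQuotient → ℂ} (hφ : Continuous φ) : MemLp φ 2 μ := by
  obtain ⟨C, -, hC⟩ := exists_norm_le_of_continuous 𝒢 hφ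
  exact MemLp.of_bound hφ.aestronglyMeasurable C (Eventually.of_forall hC)

variable {X : Type*} [MeasurableSpace X]

/-- For an `L¹` weight `f` on a second-countable Borel space `X` and a continuous `p : X → G(𝔸)`, the vector integrand `x ↦ f(x) • R(p x) F` is
Bochner integrable: it is continuous in `x` (★ strong continuity of `R`) and bounded in norm by `|f(x)| ‖F‖` (`R` is isometric).
[cite: BorelJacquet1979, §4.6] [cite: Folland1995, §3.2] -/
theorem integrable_smul_rightRegular [𝒢.IsAutomorphicMeasure μ] [TopologicalSpace X] [OpensMeasurableSpace X]
    [SecondCountableTopology X] (ν : Measure X) {p : X → 𝒢.Adelic} (hp : Continuous p) {f : X → ℂ} (hf : Integrable f ν)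
    (F : 𝒢.L2 μ) : Integrable (fun x => f x • 𝒢.rightRegular μ (p x) F) ν := by
  have hc : Continuous fun x => 𝒢.rightRegular μ (p x) F := ((𝒢.isStronglyContinuous_rightRegular_holds μ) F).comp hp
  exact hf.smul_of_top_left
    (memLp_top_of_bound hc.aestronglyMeasurable ‖F‖ (Eventually.of_forall fun x => (𝒢.norm_rightRegular_apply μ (p x) F).le))

variable [SMulInvariantMeasure 𝒢.Adelic 𝒢.automorphicQuotient μ]

/-- **The smear lies in the cyclic closed span**: `∫ f(x) • R(p x) F dν ∈ closure (span_ℂ {R(g) F : g ∈ G(𝔸)})` whenever the vector integrand is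
Bochner integrable (pair with `w ⟂ span`: `⟪w, ∫ f • R(p ·) F⟫ = ∫ f(x) ⟪w, R(p x) F⟫ = 0`; same argument as ★ organ O33.1
`integral_smul_apply_mem_closure_span`, here for an integration variable in an auxiliary space `X`). [cite: Folland1995, §3.2]
[cite: DeitmarEchterhoff2014, Prop. 6.2.1] -/
theorem integral_smul_rightRegular_mem_closure_span (ν : Measure X) (p : X → 𝒢.Adelic) (f : X → ℂ) (F : 𝒢.L2 μ)
    (hint : Integrable (fun x => f x • 𝒢.rightRegular μ (p x) F) ν) :
    (∫ x, f x • 𝒢.rightRegular μ (p x) F ∂ν) ∈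
      (Submodule.span ℂ (Set.range fun g : 𝒢.Adelic => 𝒢.rightRegular μ g F)).topologicalClosure := by
  rw [← Submodule.orthogonal_orthogonal_eq_closure, Submodule.mem_orthogonal]
  intro w hw
  rw [← integral_inner hint w]
  refine integral_eq_zero_of_ae (Eventually.of_forall fun x => ?_)
  have hgv : 𝒢.rightRegular μ (p x) F ∈ Submodule.span ℂ (Set.range fun g : 𝒢.Adelic => 𝒢.rightRegular μ g F) :=
    Submodule.subset_span ⟨p x, rfl⟩
  change ⟪w, f x • 𝒢.rightRegular μ (p x) F⟫_ℂ = 0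
  rw [inner_smul_right, Submodule.inner_left_of_mem_orthogonal hgv hw, mul_zero]

/-- **Non-vanishing pairing**: if the smear `∫ f(x) • R(p x) F dν` is NON-ZERO it pairs non-trivially with some `R(p x) F`
(★ organ O33.1 `exists_inner_translate_ne_zero` on the cyclic closed span, then the translate is moved inside the image of `p` by
unitarity: `⟪u, R(g) F⟫ ≠ 0` for some `g` already gives the claim with `g`; we record the `G(𝔸)` form). [cite: DeitmarEchterhoff2014, Prop. 6.2.1]
[cite: Liu2011, §2B Prop. 2.3 p. 862] -/
theorem exists_inner_integral_smul_rightRegular_ne_zero (ν : Measure X) (p : X → 𝒢.Adelic) (f : X → ℂ) (F : 𝒢.L2 μ)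
    (hint : Integrable (fun x => f x • 𝒢.rightRegular μ (p x) F) ν) (hne : (∫ x, f x • 𝒢.rightRegular μ (p x) F ∂ν) ≠ 0) :
    ∃ g : 𝒢.Adelic, ⟪∫ x, f x • 𝒢.rightRegular μ (p x) F ∂ν, 𝒢.rightRegular μ g F⟫_ℂ ≠ 0 :=
  exists_inner_translate_ne_zero (𝒢.rightRegular μ) F (integral_smul_rightRegular_mem_closure_span 𝒢 μ ν p f F hint) hne

/-- Translates of an `Lᵖ` function on the quotient are `Lᵖ` (the action preserves `μ`). [cite: BorelJacquet1979, §4.6] -/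
theorem memLp_comp_smul {p : ℝ≥0∞} {φ : 𝒢.automorphicQuotient → ℂ} (hφ : MemLp φ p μ) (g₀ : 𝒢.Adelic) :
    MemLp (fun x => φ (g₀ • x)) p μ :=
  hφ.comp_measurePreserving (measurePreserving_smul g₀ μ)

/-- **`[φ(g₀ • ·)] = R(g₀⁻¹)[φ]`** in `L²([G], μ)` (★ `rightRegular_apply_eq_of_ae_eq`: `(R g f)(x) = f(g⁻¹ • x)` a.e.). [cite: BorelJacquet1979, §4.6] -/
theorem toLp_comp_smul_eq_rightRegular_inv {φ : 𝒢.automorphicQuotient → ℂ} (hφ : MemLp φ 2 μ) (g₀ : 𝒢.Adelic)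
    (hφ' : MemLp (fun x => φ (g₀ • x)) 2 μ) :
    hφ'.toLp (fun x => φ (g₀ • x)) = 𝒢.rightRegular μ g₀⁻¹ (hφ.toLp φ) :=
  (𝒢.rightRegular_apply_eq_of_ae_eq μ g₀⁻¹ (hφ.toLp φ) (hφ'.toLp _) hφ.coeFn_toLp
    (by simpa only [inv_inv] using hφ'.coeFn_toLp)).symm

/-- **`⟨π(g)φ₁, φ₂⟩ = ⟪[φ₂], R(g)[φ₁]⟫_{L²}`**: the ★ matrix coefficient `∫ φ₁(g⁻¹•x) conj(φ₂ x) dμ` of two `L²` functions is the `L²` inner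
product (conjugate-linear in the FIRST slot, Mathlib `L2.inner_def`) of `[φ₂]` with `R(g)[φ₁]`. [cite: BorelJacquet1979, §4.6]
[cite: Liu2021, §B.3 (B.7) p. 101] -/
theorem quotMatrixCoeff_eq_inner {φ₁ φ₂ : 𝒢.automorphicQuotient → ℂ} (hφ₁ : MemLp φ₁ 2 μ) (hφ₂ : MemLp φ₂ 2 μ) (g : 𝒢.Adelic) :
    quotMatrixCoeff 𝒢 μ φ₁ φ₂ g = ⟪hφ₂.toLp φ₂, 𝒢.rightRegular μ g (hφ₁.toLp φ₁)⟫_ℂ := by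
  rw [L2.inner_def]
  unfold quotMatrixCoeff
  refine integral_congr_ae ?_
  filter_upwards [hφ₂.coeFn_toLp, 𝒢.rightRegular_apply_coeFn_of_ae_eq μ g (hφ₁.toLp φ₁) hφ₁.coeFn_toLp] with x hx₂ hx₁
  rw [hx₁, hx₂, RCLike.inner_apply, mul_comm]

/-- **`⟨π(g)φ₁, φ₁(g₀•·)⟩ = ⟪R(g₀⁻¹)[φ₁], R(g)[φ₁]⟫_{L²}`**. [cite: BorelJacquet1979, §4.6] [cite: Liu2011, §2B Prop. 2.3 p. 862] -/
theorem quotMatrixCoeff_translate_eq_inner {φ₁ : 𝒢.automorphicQuotient → ℂ} (hφ₁ : MemLp φ₁ 2 μ) (g₀ g : 𝒢.Adelic) :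
    quotMatrixCoeff 𝒢 μ φ₁ (fun x => φ₁ (g₀ • x)) g =
      ⟪𝒢.rightRegular μ g₀⁻¹ (hφ₁.toLp φ₁), 𝒢.rightRegular μ g (hφ₁.toLp φ₁)⟫_ℂ := by
  rw [quotMatrixCoeff_eq_inner 𝒢 μ hφ₁ (memLp_comp_smul 𝒢 μ hφ₁ g₀) g, toLp_comp_smul_eq_rightRegular_inv 𝒢 μ hφ₁ g₀]

/-- **`∫ f(x) ⟨π(p x)φ₁, φ₁(g₀•·)⟩ dν(x) = ⟪R(g₀⁻¹)[φ₁], ∫ f(x) • R(p x)[φ₁] dν(x)⟫`** whenever the vector integrand is Bochner integrable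
(Mathlib `integral_inner`, `inner_smul_right`). [cite: Liu2011, §2B Prop. 2.3 p. 862] [cite: Folland1995, §3.2] -/
theorem integral_mul_quotMatrixCoeff_translate_eq_inner {φ₁ : 𝒢.automorphicQuotient → ℂ} (hφ₁ : MemLp φ₁ 2 μ) (g₀ : 𝒢.Adelic)
    (ν : Measure X) (p : X → 𝒢.Adelic) (f : X → ℂ)
    (hint : Integrable (fun x => f x • 𝒢.rightRegular μ (p x) (hφ₁.toLp φ₁)) ν) :
    ∫ x, f x * quotMatrixCoeff 𝒢 μ φ₁ (fun y => φ₁ (g₀ • y)) (p x) ∂ν =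
      ⟪𝒢.rightRegular μ g₀⁻¹ (hφ₁.toLp φ₁), ∫ x, f x • 𝒢.rightRegular μ (p x) (hφ₁.toLp φ₁) ∂ν⟫_ℂ := by
  rw [← integral_inner hint]
  refine integral_congr_ae (Eventually.of_forall fun x => ?_)
  change f x * quotMatrixCoeff 𝒢 μ φ₁ (fun y => φ₁ (g₀ • y)) (p x) =
    ⟪𝒢.rightRegular μ g₀⁻¹ (hφ₁.toLp φ₁), f x • 𝒢.rightRegular μ (p x) (hφ₁.toLp φ₁)⟫_ℂ
  rw [inner_smul_right, quotMatrixCoeff_translate_eq_inner]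

end General

/-! ### Part B — the doubling value `Z_S(φ, φ₁, φ₁(g₀ • ·))` of socket #33s -/

section ZetaS

open NumberField IsDedekindDomain

variable (L : Type) [Field L] [NumberField L] [IsCMField L]
variable {N M n : ℕ} (e : Fin N × Fin M ≃ Fin n)
  (dV : Fin N → L) (hdV : ∀ i, IsCMField.complexConj L (dV i) = dV i)
  (dW : Fin M → L) (hdW : ∀ i, IsCMField.complexConj L (dW i) = dW i)
  (H : Matrix (Fin N) (Fin N) L)
  (S : Finset (HeightOneSpectrum (𝓞 (Fp L))))

/-- `G_∞ × G_S` is second countable (★ `instSecondCountableTopologyArch`, ★ `secondCountableTopology_localPi`). [cite: BorelJacquet1979, §4.1] -/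
theorem secondCountableTopology_places :
    SecondCountableTopology (UnitaryGroup.arch (Fp L) L (IsCMField.complexConj L) N H ×
      (Π v : S, UnitaryGroup.localPi L (IsCMField.complexConj L) N H v.1)) := by
  haveI : ∀ v : S, SecondCountableTopology (UnitaryGroup.localPi L (IsCMField.complexConj L) N H v.1) :=
    fun v => UnitaryGroup.secondCountableTopology_localPi L N (IsCMField.complexConj L) H v.1
  infer_instance

/-- `G_∞ × G_S` carries the Borel σ-algebra of its (second countable) product topology when the factors do. [cite: BorelJacquet1979, §4.1] -/
theorem borelSpace_places
    [MeasurableSpace (UnitaryGroup.arch (Fp L) L (IsCMField.complexConj L) N H)]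
    [BorelSpace (UnitaryGroup.arch (Fp L) L (IsCMField.complexConj L) N H)]
    [∀ v : HeightOneSpectrum (𝓞 (Fp L)), MeasurableSpace (UnitaryGroup.localPi L (IsCMField.complexConj L) N H v)]
    [∀ v : HeightOneSpectrum (𝓞 (Fp L)), BorelSpace (UnitaryGroup.localPi L (IsCMField.complexConj L) N H v)] :
    BorelSpace (UnitaryGroup.arch (Fp L) L (IsCMField.complexConj L) N H ×
      (Π v : S, UnitaryGroup.localPi L (IsCMField.complexConj L) N H v.1)) := by
  haveI : ∀ v : S, SecondCountableTopology (UnitaryGroup.localPi L (IsCMField.complexConj L) N H v.1) :=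
    fun v => UnitaryGroup.secondCountableTopology_localPi L N (IsCMField.complexConj L) H v.1
  infer_instance

variable [DecidableEq (HeightOneSpectrum (𝓞 (Fp L)))]
  [MeasurableSpace (UnitaryGroup.arch (Fp L) L (IsCMField.complexConj L) N H)]
  [BorelSpace (UnitaryGroup.arch (Fp L) L (IsCMField.complexConj L) N H)]
  [∀ v : HeightOneSpectrum (𝓞 (Fp L)), MeasurableSpace (UnitaryGroup.localPi L (IsCMField.complexConj L) N H v)]
  [∀ v : HeightOneSpectrum (𝓞 (Fp L)), BorelSpace (UnitaryGroup.localPi L (IsCMField.complexConj L) N H v)]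
  (νinf : Measure (UnitaryGroup.arch (Fp L) L (IsCMField.complexConj L) N H))
  (νS : ∀ v : S, Measure (UnitaryGroup.localPi L (IsCMField.complexConj L) N H v.1))
  (μ : Measure (UnitaryGroup.adelicGroupData (Fp L) L (IsCMField.complexConj L) N H).automorphicQuotient)
  [(UnitaryGroup.adelicGroupData (Fp L) L (IsCMField.complexConj L) N H).IsAutomorphicMeasure μ]
  (ιA : (UnitaryGroup.adelicGroupData (Fp L) L (IsCMField.complexConj L) N H).Adelic →*
    UnitaryGroup.adelic (Fp L) L (IsCMField.complexConj L) N (Matrix.diagonal dV))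

/-- **The doubling weight makes an integrable vector integrand**: if `f_φ(x) = φ(ι(ιA(p x), 1))` is `L¹` on `G_∞ × G_S` then
`x ↦ f_φ(x) • R(p x) F` is Bochner integrable in `L²([G])` (`p = placesEmbed S`, continuous ★ `continuous_placesEmbed`).
[cite: Liu2011, §2B Prop. 2.3 p. 862] [cite: BorelJacquet1979, §4.6] -/
theorem integrable_section_smul_rightRegular (φ : HA L e dV hdV dW hdW → ℂ)
    (F : (UnitaryGroup.adelicGroupData (Fp L) L (IsCMField.complexConj L) N H).L2 μ)
    (hf : Integrable (fun x => φ (iotaLeft L e dV hdV dW hdW (ιA (placesEmbed L H S x)))) (νinf.prod (Measure.pi νS))) :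
    Integrable (fun x => φ (iotaLeft L e dV hdV dW hdW (ιA (placesEmbed L H S x))) •
      (UnitaryGroup.adelicGroupData (Fp L) L (IsCMField.complexConj L) N H).rightRegular μ (placesEmbed L H S x) F)
      (νinf.prod (Measure.pi νS)) := by
  haveI := secondCountableTopology_places L H S
  haveI := borelSpace_places L H S
  haveI : OpensMeasurableSpace (UnitaryGroup.arch (Fp L) L (IsCMField.complexConj L) N H ×
      (Π v : S, UnitaryGroup.localPi L (IsCMField.complexConj L) N H v.1)) := BorelSpace.opensMeasurable
  exact integrable_smul_rightRegular _ μ _ (continuous_placesEmbed L H S) hf F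

/-- **`Z_S(φ, φ₁, φ₁(g₀ • ·)) = ⟪R(g₀⁻¹)[φ₁], T_{f_φ}[φ₁]⟫_{L²([G])}`** with `T_{f_φ}[φ₁] = ∫_{G_∞ × G_S} f_φ(x) • R(p x)[φ₁] d(ν_∞ ⊗ ⊗_{v∈S} ν_v)`,
for `φ₁ ∈ L²([G], μ)` and an `L¹` doubling weight `f_φ` (Fubini in the form `integral_inner`; no convergence hypothesis on `Z_S` itself is
needed: the scalar integrand is then automatically integrable). [cite: Liu2011, §2B Prop. 2.3 p. 862] [cite: BorelJacquet1979, §4.6] -/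
theorem zetaS_translate_eq_inner (φ : HA L e dV hdV dW hdW → ℂ)
    {φ₁ : (UnitaryGroup.adelicGroupData (Fp L) L (IsCMField.complexConj L) N H).automorphicQuotient → ℂ} (hφ₁ : MemLp φ₁ 2 μ)
    (g₀ : (UnitaryGroup.adelicGroupData (Fp L) L (IsCMField.complexConj L) N H).Adelic)
    (hf : Integrable (fun x => φ (iotaLeft L e dV hdV dW hdW (ιA (placesEmbed L H S x)))) (νinf.prod (Measure.pi νS))) :
    zetaS L e dV hdV dW hdW H S νinf νS μ ιA φ φ₁ (fun y => φ₁ (g₀ • y)) =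
      ⟪(UnitaryGroup.adelicGroupData (Fp L) L (IsCMField.complexConj L) N H).rightRegular μ g₀⁻¹ (hφ₁.toLp φ₁),
        ∫ x, φ (iotaLeft L e dV hdV dW hdW (ιA (placesEmbed L H S x))) •
          (UnitaryGroup.adelicGroupData (Fp L) L (IsCMField.complexConj L) N H).rightRegular μ (placesEmbed L H S x) (hφ₁.toLp φ₁)
        ∂(νinf.prod (Measure.pi νS))⟫_ℂ := by
  unfold zetaS
  exact integral_mul_quotMatrixCoeff_translate_eq_inner _ μ hφ₁ g₀ _ _ _
    (integrable_section_smul_rightRegular L e dV hdV dW hdW H S νinf νS μ ιA φ _ hf)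

/-- **Non-vanishing transfer.** If the smear `T_{f_φ}[φ₁] = ∫ f_φ(x) • R(p x)[φ₁]` of `[φ₁]` by the `L¹` doubling weight is NON-ZERO, then
`Z_S(φ, φ₁, φ₁(g₀ • ·)) ≠ 0` for some `g₀ ∈ G(𝔸)` — indeed `T_{f_φ}[φ₁]` lies in the cyclic closed span of `[φ₁]` (★ organ O33.1
`exists_inner_integral_smul_translate_ne_zero`), so it pairs non-trivially with some translate `R(g)[φ₁]`, and `g₀ = g⁻¹` works.
[cite: Liu2011, §2B Prop. 2.3 p. 862] [cite: DeitmarEchterhoff2014, Prop. 6.2.1] -/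
theorem exists_zetaS_translate_ne_zero (φ : HA L e dV hdV dW hdW → ℂ)
    {φ₁ : (UnitaryGroup.adelicGroupData (Fp L) L (IsCMField.complexConj L) N H).automorphicQuotient → ℂ} (hφ₁ : MemLp φ₁ 2 μ)
    (hf : Integrable (fun x => φ (iotaLeft L e dV hdV dW hdW (ιA (placesEmbed L H S x)))) (νinf.prod (Measure.pi νS)))
    (hne : (∫ x, φ (iotaLeft L e dV hdV dW hdW (ιA (placesEmbed L H S x))) •
          (UnitaryGroup.adelicGroupData (Fp L) L (IsCMField.complexConj L) N H).rightRegular μ (placesEmbed L H S x) (hφ₁.toLp φ₁)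
        ∂(νinf.prod (Measure.pi νS))) ≠ 0) :
    ∃ g₀ : (UnitaryGroup.adelicGroupData (Fp L) L (IsCMField.complexConj L) N H).Adelic,
      zetaS L e dV hdV dW hdW H S νinf νS μ ιA φ φ₁ (fun y => φ₁ (g₀ • y)) ≠ 0 := by
  obtain ⟨g, hg⟩ := exists_inner_integral_smul_rightRegular_ne_zero _ μ (νinf.prod (Measure.pi νS)) (placesEmbed L H S) _
    (hφ₁.toLp φ₁) (integrable_section_smul_rightRegular L e dV hdV dW hdW H S νinf νS μ ιA φ (hφ₁.toLp φ₁) hf) hne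
  refine ⟨g⁻¹, ?_⟩
  rw [zetaS_translate_eq_inner L e dV hdV dW hdW H S νinf νS μ ιA φ hφ₁ _ hf, inv_inv, Ne, inner_eq_zero_symm]
  exact hg

/-- The same for a CONTINUOUS `φ₁` on a COMPACT quotient (the frame of socket #33s, with `[φ₁] = memLp_two_of_continuous.toLp`).
[cite: Liu2011, §2B Prop. 2.3 p. 862] -/
theorem exists_zetaS_translate_ne_zero_of_continuous
    [CompactSpace (UnitaryGroup.adelicGroupData (Fp L) L (IsCMField.complexConj L) N H).automorphicQuotient]
    (φ : HA L e dV hdV dW hdW → ℂ)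
    {φ₁ : (UnitaryGroup.adelicGroupData (Fp L) L (IsCMField.complexConj L) N H).automorphicQuotient → ℂ} (hφ₁ : Continuous φ₁)
    (hf : Integrable (fun x => φ (iotaLeft L e dV hdV dW hdW (ιA (placesEmbed L H S x)))) (νinf.prod (Measure.pi νS)))
    (hne : (∫ x, φ (iotaLeft L e dV hdV dW hdW (ιA (placesEmbed L H S x))) •
          (UnitaryGroup.adelicGroupData (Fp L) L (IsCMField.complexConj L) N H).rightRegular μ (placesEmbed L H S x)
            ((memLp_two_of_continuous _ μ hφ₁).toLp φ₁)
        ∂(νinf.prod (Measure.pi νS))) ≠ 0) :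
    ∃ g₀ : (UnitaryGroup.adelicGroupData (Fp L) L (IsCMField.complexConj L) N H).Adelic,
      zetaS L e dV hdV dW hdW H S νinf νS μ ιA φ φ₁ (fun y => φ₁ (g₀ • y)) ≠ 0 :=
  exists_zetaS_translate_ne_zero L e dV hdV dW hdW H S νinf νS μ ιA φ (memLp_two_of_continuous _ μ hφ₁) hf hne

end ZetaS

end Summit.HodgeConjecture.HodgeConjecture.Cruxes.HLiu418.K2LiuZetaSInnerProduct

end
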